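import Literature.Probability.FitznerVanDerHofstad2017.Stage1Cells
import HarnessLib

/-!
# ST10′ print-pattern cell variants `xiiota2_print`, `xi3_bothtrivial_print`, `b2isq` (ESTIMATE-INVENTORY rows C-15, C-17, C-13)

pub-lace10 cell, TYPER seat (unit `pub-lace10-typer-g2`); ESTIMATE-INVENTORY rows C-15 (`xiiota2_print`), C-17
(`xi3_bothtrivial_print`) and C-13 (`b2isq`): the ST10′ PRINT-PATTERN variants of `Percolation.nb` cells 38 and 21 as positive expressions next to
the AS-CODED cells of `Stage1Cells`, with the kernel identities saying exactly which letters are exchanged.  Definitions and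
`ring` identities only; no named fact; no numeral of the record; no dimension is fixed.

HONEST FRAMING.  Three `PX` variants (the syntax of `Stage1Cells`), four cell-43 aggregates and five `eval`-identities.  They
TYPE, at the level of the abstract Stage-1 cell language (parameters `(d, ComputedSteps, MaxNumberOfSteps)`, abstract atoms and
tables), the places where the d = 10 record of pub-lace7 (`MeanFieldD10CertRev2`, stack ST10′) evaluates the PRINTED display of
[FvdH17] (resp. a print-valid majorant of an ext-printed diagram row) instead of the notebook text that `Stage1Cells` transcribes AS
CODED, and the identities say exactly which letters are exchanged.  Nothing here is a bound on a percolation quantity: the analytic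
licences (the weighted diagrammatic bounds (5.36)/(5.39) with the trivial-end `J`-rule, the row-6 entry majorisation) are Level-U
statements over the block letters of `NobleWeightedBlocks` / `NobleBlocks` and are NOT proved or stated here; no d = 10 number is
read; no recipe is assembled; no claim about percolation in any dimension.  pub-lace10 Phase-0 item P0.1 (RULING D47 (2)(b):
T-2-independent Level-C groundwork — drafted, referee-fidelity-signed REF-CHECK-12 items 50–52, numeral-free, general d); the
typing sheet with the print / notebook / tree / lace7 locators row by row is the pub-lace10 cell file `typed/PRINTED-ROWS.md`.

Source displays (R. Fitzner, R. van der Hofstad, *Mean-field behavior for nearest-neighbor percolation in d > 10*,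
Electron. J. Probab. 22 (2017) no. 43 [FvdH17]; journal page = Project-Euclid PDF page; TeX = arXiv:1506.07977v2 source
`PercPaper_arxiv2017.tex`):
* Prop. 5.6 (5.39), EJP p. 49, TeX l.9587–9593 (N ≥ 2 even): `Σ_x ‖x‖₂² Ξ^{(N),ι}_p(x) ≤ (N+2)[h^{ι,II}(B̄^ι)^{N−1} P⃗ +
  P⃗^ι(B^ι)^{N−1}(H^{(3)}P⃗^E + A^ι h⃗^E)] + (N+2)𝟙{N≥4}Σ_M … + (N+2)(P⃗^ι(B^ι)^{N−1}Ā^ι P⃗^E)` — the right-end product is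
  `A^ι h⃗^E`, UN-transposed (as also in (5.38), (5.40), (5.41)); `P⃗` without superscript in the first term AS PRINTED.
* Prop. 5.5 (5.36), EJP p. 49, TeX l.9564–9569 (N ≥ 2 odd): `Σ_x ‖x‖₂² Ξ^{(N)}_p(x) ≤ (N+2)[h⃗^S(A^ι)^T(B̄^ι)^{N−1}P⃗^E +
  P⃗^S(B^ι)^{N−1}(H^{(2)}P⃗^E + A^ι h⃗^E)] + (N+2)Σ_{M=0}^{(N−3)/2} P⃗^S(B^ι)^{2M}(C^{(1)}B̄^ι + B^ιC^{(2)})(B̄^ι)^{N−3−2M}P⃗^E`.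
* §6.2.1 (6.55) and the sentence after it, EJP p. 61, TeX l.10295–10301: "`‖x‖₂² ≤ J Σ_{i=1}^J ‖x_i‖₂²` … we improve the
  bounds for N = 2, 3 by considering the special case that the left- and/or right-most triangle are trivial. Doing this
  we reduce the leading factor J originating from (6.55), by one or two."  (The bracket coefficients 3/4 resp. 3/4/4/5
  below are `J − #(trivial end triangles)`, `J = N + 2`; pub-lace7 referee TOKENPASS-R3-R6-RULING.md l.11–18.)
* Extended version arXiv:1506.07977v2 App. B Table 10 «Diagrams and definition of `B^{(2),ι,a,b}(0,v,x,y)`» (TeX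
  l.10515–10539), row 6 (`a ≥ 2, b ≥ 2`, `d_𝒞̃(u,w) ≥ 2`, l.10535–10538): `B_{1,1}(u−y,w−y) × P_{1̲,0,1,2,0}(e_ι,x,u,w,v)` — not in
  the journal version; the notebook's `Bound[B2i,2,2,s]` second summand (In[1193], carver transcript l.452–463) is one two-point
  function short of it (b2b D82; pub-lace7 X3-RULING §1) and `OpenBubble,2 · OpenSquare,4` is the print-valid majorant (§2).
* Notebook `Percolation.nb` In[1208] (carver transcript `b2b/lace/carver/nbtxt/Percolation.txt` l.793–801; cell 38 of the
  transcript `Stage1Cells` cites): `Bound[XiIota,2,Delta,0,s] = … + 4(hII.Bbar.PENT + Piota.B.(H3.PENT + Transpose[Aiota].hE))`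
  and `Bound[Xi,3,Delta,s] = 3({1,0,0}.B.B.H3.{1,0,0} + {1,0,0}.(B.C1 + C2.Bbar).{1,0,0}) + 4(…) + 4(…) + 5(…)`.
* pub-lace7 record levers (`pub-lace7/engine/eng2/levers/`): `xiiota2_print.json` (cell [115]:
  `Transpose[Matrix[Aiota,s]].Vector[hE,s]` ↦ `Matrix[Aiota,s].Vector[hE,s]`), `xi3_bothtrivial_print.json` (cell [115]:
  `3(u.B.B.H3.u + u.(B.C1 + C2.Bbar).u)` ↦ `3(u.B.B.H2.u + u.(C1.Bbar + B.C2).u)`), `b2isq.json` (cell [71]: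
  `Bound[OpenBubble,2,s] Bound[OpenTriangle,4,s]` ↦ `Bound[OpenBubble,2,s] Bound[OpenSquare,4,s]`); referee rulings F24 (l.20–31) and
  F26/F26′ (l.47–67, l.100–105) of `pub-lace7/referee/TOKENPASS-R3-R6-RULING.md`, `pub-lace7/referee/X3-RULING.md` §2/§4; TOKENS-ST10.md rows l.70, l.82, l.84.

[cite: FitznerVanDerHofstad2017, Prop. 5.5 (5.36) and Prop. 5.6 (5.39) (EJP 22 no. 43 p. 49); §6.2.1 (6.55) (p. 61); extended version App. B Table 10; notebook Percolation.nb cells 21, 38, 43 (In[1193], In[1208])]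
-/

namespace Literature.Probability.FitznerVanDerHofstad2017
namespace Stage1Cells

open PX

section Cells

variable (P : Params)

/-! ## C-15 `xiiota2_print`: `Bound[XiIota,2,Delta,0,s]` with the printed right-end product `A^ι h^E` -/

/-- **ST10′ `xiiota2_print` (inventory row C-15).**  Cell 38 `Bound[XiIota,2,Delta,0,s]` read with the right-end product
AS PRINTED in Prop. 5.6 (5.39) at `N = 2`: `P^ι.B.(H3.PENT + Aiota.hE)` — `Aiota` un-transposed — everything else verbatim
as in the as-coded cell `Stage1Cells.XiIota2D0` (bracket coefficients `3/4 = J − #(trivial ends)`, `J = N + 2 = 4`).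
[cite: FitznerVanDerHofstad2017, Prop. 5.6 (5.39) (EJP 22 no. 43 p. 49; arXiv:1506.07977v2 TeX l.9587–9593); §6.2.1 (6.55) (p. 61); notebook Percolation.nb cell 38 (In[1208])] -/
def XiIota2D0print : T :=
  C 3 * dot (vecMul (vecMul (Piota P) (B P)) (AiotaBar P)) e0 + C 4 * dot (vecMul (vecMul (Piota P) (B P)) (AiotaBar P)) (PENT P)
    + C 3 * (dot (vecMul (hII P) (Bbar P)) e0 + dot (vecMul (vecMul (Piota P) (B P)) (H3 P)) e0)
    + C 4 * (dot (vecMul (hII P) (Bbar P)) (PENT P)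
          + dot (vecMul (Piota P) (B P)) (vadd (mulVec (H3 P) (PENT P)) (mulVec (Aiota P) (hE P))))

/-! ## C-17 `xi3_bothtrivial_print`: `Bound[Xi,3,Delta,s]` with the printed (5.36) rail pattern in the both-trivial bracket -/

/-- **ST10′ `xi3_bothtrivial_print` (inventory row C-17).**  Cell 38 `Bound[Xi,3,Delta,s]` whose both-trivial bracket
(coefficient `3 = J − 2`, `J = 5`) is read in the PRINTED Prop. 5.5 (5.36) rail pattern restricted to `P^S, P^E ↦ u =
(1,0,0)`: `3·(u.B.B.H2.u + u.(C1.Bbar + B.C2).u)` (the notebook codes the rail-swapped `3·(u.B.B.H3.u + u.(B.C1 +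
C2.Bbar).u)`, typed as coded in `Stage1Cells.Xi3D`); the one-trivial and non-trivial brackets (coefficients `4, 4, 5`)
verbatim as coded, which there already follow the (5.36) rails (`C1BbarBC2 = C1.Bbar + B.C2`, `H2PENTAhE = H2.PENT + Aiota.hE`).
[cite: FitznerVanDerHofstad2017, Prop. 5.5 (5.36) (EJP 22 no. 43 p. 49; arXiv:1506.07977v2 TeX l.9564–9569); §6.2.1 (6.55) (p. 61); notebook Percolation.nb cell 38 (In[1208])] -/
def Xi3Dprint : T :=
  C 3 * (dot (vecMul (vecMul (vecMul e0 (B P)) (B P)) (H2 P)) e0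
          + dot (vecMul e0 (C1BbarBC2 P)) e0)
    + C 4 * (dot (vecMul (vecMul e0 (B P)) (B P)) (H2PENTAhE P) + dot (vecMul e0 (C1BbarBC2 P)) (PENT P))
    + C 4 * (dot (vecMul (vecMul (hSAt P) (Bbar P)) (Bbar P)) e0 + dot (vecMul (vecMul (PSNT P) (B P)) (B P)) (mulVec (H2 P) e0)
          + dot (vecMul (PSNT P) (C1BbarBC2 P)) e0)
    + C 5 * (dot (vecMul (vecMul (hSAt P) (Bbar P)) (Bbar P)) (PENT P)
          + dot (vecMul (vecMul (PSNT P) (B P)) (B P)) (H2PENTAhE P) + dot (vecMul (PSNT P) (C1BbarBC2 P)) (PENT P))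

/-! ## C-13 `b2isq`: `Bound[B2i,2,2,s]` with the G1 split `OpenBubble,2 · OpenSquare,4` of the ext-printed row 6 of Table 10 -/

/-- **ST10′ `b2isq` (inventory row C-13).**  Cell 21 `Bound[B2i,a,b,s]` whose `(2,2)` entry's SECOND summand is read as the
print-valid majorant `OpenBubble,2 · OpenSquare,4` (G1 split) of row 6 (`a ≥ 2, b ≥ 2`, `d_𝒞̃(u,w) ≥ 2`:
`B_{1,1}(u−y,w−y) × P_{1̲,0,1,2,0}(e_ι,x,u,w,v)`) of [FvdH17-ext] App. B Table 10 «Diagrams and definition of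
`B^{(2),ι,a,b}(0,v,x,y)`», replacing the coded `OpenBubble,2 · OpenTriangle,4` (one two-point function short; pub-lace7
referee X3-RULING.md §1–§2, b2b DIVERGENCE D82); every other entry verbatim as coded in `Stage1Cells.B2i`.  The open-square
factor is the tree's AS-CODED cell `openSquare` (device D26 literal `10`s kept; token `d27under` = inventory row C-4 concerns
that cell and is NOT applied here).
[cite: FitznerVanDerHofstad2017, extended version arXiv:1506.07977v2 App. B Table 10 row 6 (TeX l.10515–10539, row l.10535–10538); notebook Percolation.nb cell 21 (In[1193], carver transcript l.452–463)] -/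
def B2isq : Mat :=
  !![0, 0, bubble P 3 1 * triangle P 4 0 + triangle P 4 0 * openTriangle P 3 0;
     0, 0, bubble P 3 1 * triangle P 4 1 + triangle P 4 1 * openTriangle P 3 0;
     0, 0, bubble P 3 1 * openTriangle P 3 0 + openBubble P 2 0 * openSquare P 4 0]

/-- Cell 30 with the ST10′ `b2isq` entry: `B = AiotaNonRep.A + Aiota PS₀ + B2i[sq]` — the matrix every `N ≥ 2` cell and tail
reads (cells 38–43), so a Level-C recipe carrying `b2isq` re-instantiates them over `Bsq`.
[cite: FitznerVanDerHofstad2017, notebook Percolation.nb cell 30 (transcript l.869–872); extended version App. B Table 10 (TeX l.10515–10539)] -/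
def Bsq : Mat := madd (madd (matMul (AiotaNR P) (A P)) (smul (PS P 0) (Aiota P))) (B2isq P)

/-! ## The ST10′ aggregates of cell 43 that read the two variants (`T″₀` form, as in `Stage1Cells`) -/

/-- Cell 43 (`T″₀`) with the ST10′ variant: `Bound[Xi,Odd,Delta,s] = Xi₁Δ + Xi₃Δ[print]`. [cite: FitznerVanDerHofstad2017, notebook Percolation.nb cell 43 (transcript l.1182–1202); Prop. 5.5 (5.36) (p. 49)] -/
def XiOddDprint : T := Xi1D P + Xi3Dprint P
/-- Cell 43 with the ST10′ variant: `Bound[Xi,Absolut,Delta,s] = OddΔ[print] + EvenΔ`. [cite: FitznerVanDerHofstad2017, notebook Percolation.nb cell 43; Prop. 5.5 (5.36) (p. 49)] -/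
def XiAbsDprint : T := XiOddDprint P + XiEvenD P
/-- Cell 43 (`T″₀`) with the ST10′ variant: `Bound[XiIota,Even,Delta,0,s] = XiIota₀Δ0 + XiIota₂Δ0[print]`. [cite: FitznerVanDerHofstad2017, notebook Percolation.nb cell 43; Prop. 5.6 (5.39) (p. 49)] -/
def XiIotaEvenD0print : T := XiIota0D0 P + XiIota2D0print P
/-- Cell 43 with the ST10′ variant: `Bound[XiIota,Absolut,Delta,0,s] = OddΔ0 + EvenΔ0[print]`. [cite: FitznerVanDerHofstad2017, notebook Percolation.nb cell 43; Prop. 5.6 (5.39) (p. 49)] -/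
def XiIotaAbsD0print : T := XiIotaOddD0 P + XiIotaEvenD0print P

end Cells

/-! ## Kernel identities: exactly which letters the two variants exchange (under the real semantics `PX.eval`) -/

section Identities

variable (P : Params) (va : Atom → ℝ) (vt : TKey → ℝ)

/-- **`xiiota2_print` vs as coded.**  Under any valuation, `⟦XiIota2D0print⟧ + 4·⟦Piota.B.(Aiotaᵀ.hE)⟧ =
⟦XiIota2D0⟧ + 4·⟦Piota.B.(Aiota.hE)⟧`: the variant replaces the single right-end product `Transpose[Aiota].hE` of the
notebook by the printed `Aiota.hE` and changes nothing else (pub-lace7 referee F24).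
[cite: FitznerVanDerHofstad2017, Prop. 5.6 (5.39) (EJP 22 no. 43 p. 49); notebook Percolation.nb cell 38 (In[1208])] -/
theorem eval_XiIota2D0print_add (P : Params) :
    eval va vt (XiIota2D0print P) + 4 * eval va vt (dot (vecMul (Piota P) (B P)) (mulVec (tr (Aiota P)) (hE P))) =
      eval va vt (XiIota2D0 P) + 4 * eval va vt (dot (vecMul (Piota P) (B P)) (mulVec (Aiota P) (hE P))) := by
  simp only [XiIota2D0print, XiIota2D0, dot, vecMul, mulVec, vadd, tr, eval_add, eval_mul, eval_C]
  ring

/-- **`xi3_bothtrivial_print` vs as coded.**  Under any valuation, `⟦Xi3Dprint⟧ + 3·⟦u.B.B.H3.u + u.(B.C1 + C2.Bbar).u⟧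
= ⟦Xi3D⟧ + 3·⟦u.B.B.H2.u + u.(C1.Bbar + B.C2).u⟧` (`u = e0`): the variant swaps the rails `H3 ↦ H2`, `B.C1 + C2.Bbar ↦
C1.Bbar + B.C2` in the both-trivial bracket only (pub-lace7 referee F26; the coded form is licensed as a print-valid
alternative by F26′, not used by the d = 10 record).
[cite: FitznerVanDerHofstad2017, Prop. 5.5 (5.36) (EJP 22 no. 43 p. 49); notebook Percolation.nb cell 38 (In[1208])] -/
theorem eval_Xi3Dprint_add (P : Params) :
    eval va vt (Xi3Dprint P)
        + 3 * eval va vt (dot (vecMul (vecMul (vecMul e0 (B P)) (B P)) (H3 P)) e0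
            + dot (vecMul e0 (madd (matMul (B P) (C1 P)) (matMul (C2 P) (Bbar P)))) e0) =
      eval va vt (Xi3D P)
        + 3 * eval va vt (dot (vecMul (vecMul (vecMul e0 (B P)) (B P)) (H2 P)) e0
            + dot (vecMul e0 (C1BbarBC2 P)) e0) := by
  simp only [Xi3Dprint, Xi3D, C1BbarBC2, dot, vecMul, madd, matMul, eval_add, eval_mul, eval_C]
  ring

/-- `⟦e0 0⟧ = 1`. [folklore] -/
private theorem eval_e0_zero : eval va vt (e0 0 : T) = 1 := by
  show eval va vt (PX.num 1) = 1
  simp [eval]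

/-- `⟦e0 1⟧ = 0`. [folklore] -/
private theorem eval_e0_one : eval va vt (e0 1 : T) = 0 := by
  show eval va vt (PX.num 0) = 0
  simp [eval]

/-- `⟦e0 2⟧ = 0`. [folklore] -/
private theorem eval_e0_two : eval va vt (e0 2 : T) = 0 := by
  show eval va vt (PX.num 0) = 0
  simp [eval]

/-- The both-trivial bracket of the print variant IS the `(0,0)`-entry pattern of (5.36) at `N = 3`:
`⟦u.B.B.H2.u + u.(C1.Bbar + B.C2).u⟧ = ⟦(B.B.H2)₀₀⟧ + ⟦(C1.Bbar)₀₀⟧ + ⟦(B.C2)₀₀⟧` (`u = e0 = (1,0,0)`).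
[cite: FitznerVanDerHofstad2017, Prop. 5.5 (5.36) (EJP 22 no. 43 p. 49)] -/
theorem eval_bothTrivialBracket_print (P : Params) :
    eval va vt (dot (vecMul (vecMul (vecMul e0 (B P)) (B P)) (H2 P)) e0 + dot (vecMul e0 (C1BbarBC2 P)) e0) =
      eval va vt (matMul (matMul (B P) (B P)) (H2 P) 0 0) + eval va vt (matMul (C1 P) (Bbar P) 0 0)
        + eval va vt (matMul (B P) (C2 P) 0 0) := by
  simp only [C1BbarBC2, dot, vecMul, madd, matMul, eval_add, eval_mul, eval_e0_zero, eval_e0_one, eval_e0_two]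
  ring

/-- **`b2isq` vs as coded.**  `⟦B2isq₂₂⟧ + ⟦OpenBubble₂ · OpenTriangle₄⟧ = ⟦B2i₂₂⟧ + ⟦OpenBubble₂ · OpenSquare₄⟧` under every
valuation: the variant exchanges the single factor `OpenTriangle,4 ↦ OpenSquare,4` in the second summand of the `(2,2)` entry.
[cite: FitznerVanDerHofstad2017, extended version arXiv:1506.07977v2 App. B Table 10 row 6 (TeX l.10535–10538); notebook Percolation.nb cell 21 (In[1193])] -/
theorem eval_B2isq_22_add (P : Params) :
    eval va vt (B2isq P 2 2) + eval va vt (openBubble P 2 0 * openTriangle P 4 0) =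
      eval va vt (B2i P 2 2) + eval va vt (openBubble P 2 0 * openSquare P 4 0) := by
  have h1 : B2isq P 2 2 = bubble P 3 1 * openTriangle P 3 0 + openBubble P 2 0 * openSquare P 4 0 := rfl
  have h2 : B2i P 2 2 = bubble P 3 1 * openTriangle P 3 0 + openBubble P 2 0 * openTriangle P 4 0 := rfl
  rw [h1, h2]
  simp only [eval_add, eval_mul]
  ring

/-- Off the `(2,2)` entry the variant IS the coded matrix. [cite: FitznerVanDerHofstad2017, notebook Percolation.nb cell 21 (In[1193])] -/
theorem B2isq_apply_of_ne (P : Params) (a b : Fin 3) (h : (a, b) ≠ (2, 2)) : B2isq P a b = B2i P a b := by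
  fin_cases a <;> fin_cases b <;> simp_all [B2isq, B2i]

end Identities

end Stage1Cells
end Literature.Probability.FitznerVanDerHofstad2017
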